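import Summits.Parity.GeneralizedHardyLittlewood.Theorems.GreenTaoLevelTwoMNTwoVerticalOfPropNineteen
import Summits.Parity.GeneralizedHardyLittlewood.Theorems.GreenTaoLevelTwoMNTwoPropNineteenOfInverse

/-!
# Route `GreenTaoLevelTwo`, crux `MNTwo` (stmt-Parity-21276), line `birth`, stub `stub_mnVertical`:
# the stub from the major-arc inverse statement FOR LARGE `N` (repair of the `hInv` target)

Blocks V4–V8 assembly of the `stub_mnVertical` census (B. Green, T. Tao, *Quadratic uniformity of
the Möbius function*, Ann. Inst. Fourier 58 (2008) = arXiv:math/0606087).  The landed reduction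
`…MNTwoVerticalOfInverse.stub_mnVertical_of_majorArcInverse` asks for the inverse statement `hInv k`
for EVERY `N ≥ 2`.  As stated that hypothesis is not satisfiable: for `N` small compared with `A`
(`N/log^A N ≤ 1/N`, e.g. `N = 9`, `A ≥ 7`) a weight supported at a single prime `n₀` with
`ψ(n₀) = 1/N` meets every hypothesis for arbitrarily small `ρ`, while the conclusion demands
`(log N)^{-B} ≤ ρ₃ ≤ ρ` (see the cell bus note of hand -2-g5).  The source only claims the inverse
statement for `N` large depending on `A` ("Assume that `N` is large depending on `A`", Lemmas 23 and
24; and `ρ₀ ≳ 1`, eq. (r-big), needs `N/log^A N ≫ 1`).  This def-free file re-targets the chain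
accordingly:

* `propNineteen_of_majorArcInverse_largeN` — Proposition 19 (verbatim the hypothesis `hP k` of
  `…MNTwoSectionEightComplex.sum_moebius_localQuadratic_complex_le`) from the inverse statement
  required only for `N ≥ N₀(A)`; small `N` are absorbed into the constant;
* `stub_mnVertical_of_majorArcInverse_largeN` — `(∀ k, hInvL k) → stub_mnVertical` (signature
  verbatim, `B = 1`).

So THE REMAINING TARGET for `stub_mnVertical` is `hInvL k` (all `k`): the hypothesis of
`propNineteen_of_majorArcInverse_largeN k`, i.e. `hInv k` with `∀ N ≥ 2` weakened to
`∃ N₀, ∀ N ≥ N₀, N ≥ 2 →`.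

References: [GreenTao2008QuadraticMobius] arXiv:math/0606087, §2, Prop. 19, §§9–12 (Lemmas 23, 24).
-/

noncomputable section

open Finset Real ArithmeticFunction
open scoped ArithmeticFunction.Moebius FourierTransform
open Literature.NumberTheory.Sieve
open Literature.NumberTheory.Sieve.GreenTaoLevelTwo (HX IsCompatMetric IsBoxComparable heisenbergWith
  InHeisClass)

namespace Summit.Parity.GeneralizedHardyLittlewood.GreenTaoLevelTwoMNTwoVerticalOfInverseLargeN

open Summit.Parity.GeneralizedHardyLittlewood.GreenTaoLevelTwoMNTwoMajorArcFinal
  (norm_sum_moebius_major_arc_le)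
open Summit.Parity.GeneralizedHardyLittlewood.GreenTaoLevelTwoMNTwoPropNineteenGlue
  (sum_toCircle_eq_sum_fourierChar cube_vanish_of_integral)
open Summit.Parity.GeneralizedHardyLittlewood.GreenTaoLevelTwoMNTwoBohrGauge
  (bddAbove_range_norm iSup_norm_nonneg)
open Summit.Parity.GeneralizedHardyLittlewood.GreenTaoLevelTwoMNTwoPropNineteenOfInverse
  (weight_le_three_halves)
open Summit.Parity.GeneralizedHardyLittlewood.GreenTaoLevelTwoMNTwoVerticalOfPropNineteen
  (stub_mnVertical_of_prop19)

variable {k : ℕ}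

/-- **Proposition 19 from the major-arc inverse statement FOR LARGE `N` (GT 2008b §§9–12).**  The
hypothesis `hInv` is the deliverable of §§9–11: whenever the Prop-19 data `(α, n₀, ρ, φ, ψ)` has a
large sum, `‖Σ_{N<n≤2N} μ(n)ψ(n)e(−φ(n))‖ ≥ N/log^A N`, the phase `φ'' = (↑∘φ)''` (based at `n₀`) is
major arc of height `log^B N`: `1 ≤ q ≤ log^B N`, `0 ≤ K ≤ log^B N`, `log^{-B} N ≤ ρ₃ ≤ ρ`, and
`‖q•φ''(a,b)‖ ≤ K ν(a)ν(b)` for `ν a, ν b < ρ₃`.  The conclusion is Proposition 19 verbatim as the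
hypothesis `hP` of `…MNTwoSectionEight.sum_moebius_localQuadratic_dyadic_le`.
This is `…MNTwoPropNineteenOfInverse.propNineteen_of_majorArcInverse` with the inverse statement
required only for `N ≥ N₀(A)` ("Assume that `N` is large depending on `A`", Lemmas 23, 24); the
range `N < N₀` is absorbed by the trivial bound `‖Σ‖ ≤ (3/2)N ≤ (3/2) log^A(N₀+2) · N/log^A N`.
[cite: GreenTao2008QuadraticMobius, Proposition 19, §§9–12] -/
theorem propNineteen_of_majorArcInverse_largeN (k : ℕ)
    (hInv : ∀ A : ℝ, 0 < A → ∃ B : ℝ, 0 ≤ B ∧ ∃ N₀ : ℕ, ∀ N : ℕ, N₀ ≤ N → 2 ≤ N →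
      ∀ (α : Fin k → ℝ) (n₀ : ℤ) (ρ : ℝ),
      0 < ρ → 100000 * ρ < 1 →
      (∀ n : ℤ, ((∀ i, ‖((((n - n₀ : ℤ) : ℝ) * α i : ℝ) : AddCircle (1 : ℝ))‖ +
          |((n - n₀ : ℤ) : ℝ)| / N < 100 * ρ) ∧ |((n - n₀ : ℤ) : ℝ)| / N < 100 * ρ) →
        (N : ℤ) < n ∧ n ≤ 2 * N) →
      ∀ φ : ℤ → ℝ,
        (∀ n h₁ h₂ h₃ : ℤ,
          (∀ e₁ e₂ e₃ : ℕ, e₁ ≤ 1 → e₂ ≤ 1 → e₃ ≤ 1 →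
            (∀ i, ‖((((n + e₁ * h₁ + e₂ * h₂ + e₃ * h₃ - n₀ : ℤ) : ℝ) * α i : ℝ) :
                AddCircle (1 : ℝ))‖ +
              |((n + e₁ * h₁ + e₂ * h₂ + e₃ * h₃ - n₀ : ℤ) : ℝ)| / N < 100 * ρ) ∧
            |((n + e₁ * h₁ + e₂ * h₂ + e₃ * h₃ - n₀ : ℤ) : ℝ)| / N < 100 * ρ) →
          ∃ z : ℤ, φ (n + h₁ + h₂ + h₃) - φ (n + h₁ + h₂) - φ (n + h₁ + h₃) - φ (n + h₂ + h₃)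
            + φ (n + h₁) + φ (n + h₂) + φ (n + h₃) - φ n = z) →
        ∀ ψ : ℤ → ℝ, (∀ n, 0 ≤ ψ n) →
          (∀ n, ψ n ≠ 0 →
            (∀ i, ‖((((n - n₀ : ℤ) : ℝ) * α i : ℝ) : AddCircle (1 : ℝ))‖ +
                |((n - n₀ : ℤ) : ℝ)| / N < ρ) ∧ |((n - n₀ : ℤ) : ℝ)| / N < ρ) →
          (∀ (n n' : ℤ) (t : ℝ), 0 ≤ t →
            (∀ i, ‖((((n - n' : ℤ) : ℝ) * α i : ℝ) : AddCircle (1 : ℝ))‖ ≤ t) →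
              |ψ n - ψ n'| ≤ t + |((n - n' : ℤ) : ℝ)| / N) →
          (N : ℝ) / Real.log N ^ A ≤
            ‖∑ n ∈ Ioc N (2 * N), ((μ n : ℝ) : ℂ) * ((ψ n : ℝ) : ℂ) * (𝐞 (-(φ n)) : ℂ)‖ →
          ∃ (q : ℕ) (K ρ₃ : ℝ), 1 ≤ q ∧ (q : ℝ) ≤ Real.log N ^ B ∧ 0 ≤ K ∧ K ≤ Real.log N ^ B ∧
            (Real.log N ^ B)⁻¹ ≤ ρ₃ ∧ ρ₃ ≤ ρ ∧
            ∀ a b : ℤ,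
              (⨆ i : Fin k, ‖(((a : ℝ) * α i : ℝ) : AddCircle (1 : ℝ))‖) + |(a : ℝ)| / N < ρ₃ →
              (⨆ i : Fin k, ‖(((b : ℝ) * α i : ℝ) : AddCircle (1 : ℝ))‖) + |(b : ℝ)| / N < ρ₃ →
              ‖q • ((((φ (n₀ + a + b) : ℝ) : UnitAddCircle)) - ((φ (n₀ + a) : ℝ) : UnitAddCircle)
                - ((φ (n₀ + b) : ℝ) : UnitAddCircle) + ((φ n₀ : ℝ) : UnitAddCircle))‖ ≤
                K * ((⨆ i : Fin k, ‖(((a : ℝ) * α i : ℝ) : AddCircle (1 : ℝ))‖) + |(a : ℝ)| / N) *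
                  ((⨆ i : Fin k, ‖(((b : ℝ) * α i : ℝ) : AddCircle (1 : ℝ))‖) + |(b : ℝ)| / N)) :
    ∀ A : ℝ, 0 < A → ∃ C : ℝ, ∀ N : ℕ, 2 ≤ N → ∀ (α : Fin k → ℝ) (n₀ : ℤ) (ρ : ℝ),
      0 < ρ → 100000 * ρ < 1 →
      (∀ n : ℤ, ((∀ i, ‖((((n - n₀ : ℤ) : ℝ) * α i : ℝ) : AddCircle (1 : ℝ))‖ +
          |((n - n₀ : ℤ) : ℝ)| / N < 100 * ρ) ∧ |((n - n₀ : ℤ) : ℝ)| / N < 100 * ρ) →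
        (N : ℤ) < n ∧ n ≤ 2 * N) →
      ∀ φ : ℤ → ℝ,
        (∀ n h₁ h₂ h₃ : ℤ,
          (∀ e₁ e₂ e₃ : ℕ, e₁ ≤ 1 → e₂ ≤ 1 → e₃ ≤ 1 →
            (∀ i, ‖((((n + e₁ * h₁ + e₂ * h₂ + e₃ * h₃ - n₀ : ℤ) : ℝ) * α i : ℝ) :
                AddCircle (1 : ℝ))‖ +
              |((n + e₁ * h₁ + e₂ * h₂ + e₃ * h₃ - n₀ : ℤ) : ℝ)| / N < 100 * ρ) ∧
            |((n + e₁ * h₁ + e₂ * h₂ + e₃ * h₃ - n₀ : ℤ) : ℝ)| / N < 100 * ρ) →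
          ∃ z : ℤ, φ (n + h₁ + h₂ + h₃) - φ (n + h₁ + h₂) - φ (n + h₁ + h₃) - φ (n + h₂ + h₃)
            + φ (n + h₁) + φ (n + h₂) + φ (n + h₃) - φ n = z) →
        ∀ ψ : ℤ → ℝ, (∀ n, 0 ≤ ψ n) →
          (∀ n, ψ n ≠ 0 →
            (∀ i, ‖((((n - n₀ : ℤ) : ℝ) * α i : ℝ) : AddCircle (1 : ℝ))‖ +
                |((n - n₀ : ℤ) : ℝ)| / N < ρ) ∧ |((n - n₀ : ℤ) : ℝ)| / N < ρ) →
          (∀ (n n' : ℤ) (t : ℝ), 0 ≤ t →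
            (∀ i, ‖((((n - n' : ℤ) : ℝ) * α i : ℝ) : AddCircle (1 : ℝ))‖ ≤ t) →
              |ψ n - ψ n'| ≤ t + |((n - n' : ℤ) : ℝ)| / N) →
          ‖∑ n ∈ Ioc N (2 * N), ((μ n : ℝ) : ℂ) * ((ψ n : ℝ) : ℂ) * (𝐞 (-(φ n)) : ℂ)‖ ≤
            C * N / Real.log N ^ A := by
  intro A hA
  obtain ⟨B, hB0, N₀, hB⟩ := hInv A hA
  have hLA0 : 0 ≤ Real.log ((N₀ : ℝ) + 2) ^ A :=
    Real.rpow_nonneg (Real.log_nonneg (by linarith [(Nat.cast_nonneg N₀ : (0 : ℝ) ≤ N₀)])) A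
  set D : ℕ := (k + 1) * (k + 3) + 2 * k + 3 with hD
  obtain ⟨C₁, hC₁0, hC₁⟩ := norm_sum_moebius_major_arc_le k (A := A + B * D) (by positivity)
  refine ⟨2 * C₁ + 2 + 3 / 2 * Real.log ((N₀ : ℝ) + 2) ^ A, ?_⟩
  intro N hN α n₀ ρ hρ hρ1 hball φ hφ ψ hψ0 hsupp hlip
  have hN1 : 1 ≤ N := by omega
  have hNr : (0 : ℝ) < N := by exact_mod_cast (show 0 < N by omega)
  have hlogpos : 0 < Real.log N := Real.log_pos (by exact_mod_cast (show 1 < N by omega))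
  have hLA : 0 < Real.log N ^ A := Real.rpow_pos_of_pos hlogpos A
  -- trivial bound `‖Σ‖ ≤ (3/2) N`
  have hψ32 : ∀ n, ψ n ≤ 3 / 2 :=
    weight_le_three_halves α hN1 n₀ (by linarith) ψ hψ0 hsupp hlip
  have htriv : ‖∑ n ∈ Ioc N (2 * N), ((μ n : ℝ) : ℂ) * ((ψ n : ℝ) : ℂ) * (𝐞 (-(φ n)) : ℂ)‖ ≤
      3 / 2 * N := by
    calc _ ≤ ∑ n ∈ Ioc N (2 * N), ‖((μ n : ℝ) : ℂ) * ((ψ n : ℝ) : ℂ) * (𝐞 (-(φ n)) : ℂ)‖ :=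
          norm_sum_le _ _
      _ ≤ ∑ _n ∈ Ioc N (2 * N), (3 / 2 : ℝ) := Finset.sum_le_sum fun n _ => by
          rw [norm_mul, norm_mul, Circle.norm_coe, mul_one, Complex.norm_real, Complex.norm_real,
            Real.norm_eq_abs, Real.norm_eq_abs, abs_of_nonneg (hψ0 n)]
          have h1 : |((μ n : ℝ))| ≤ 1 := by exact_mod_cast abs_moebius_le_one
          have := hψ32 n
          nlinarith [abs_nonneg ((μ n : ℝ)), hψ0 n]
      _ = 3 / 2 * N := by simp [show 2 * N - N = N by omega]; ring
  -- Case: the sum is small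
  by_cases hcase : ‖∑ n ∈ Ioc N (2 * N), ((μ n : ℝ) : ℂ) * ((ψ n : ℝ) : ℂ) * (𝐞 (-(φ n)) : ℂ)‖ <
      (N : ℝ) / Real.log N ^ A
  · refine hcase.le.trans ?_
    rw [div_le_div_iff_of_pos_right hLA]
    have : 0 ≤ Real.log ((N₀ : ℝ) + 2) ^ A := hLA0
    nlinarith
  push Not at hcase
  -- Case `log N ≤ 1`: trivial bound
  by_cases hsmall : Real.log N ≤ 1
  · have hΛ1 : Real.log N ^ A ≤ 1 := Real.rpow_le_one hlogpos.le hsmall hA.le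
    refine htriv.trans ?_
    rw [le_div_iff₀ hLA]
    have : 0 ≤ Real.log ((N₀ : ℝ) + 2) ^ A := hLA0
    nlinarith [mul_le_mul_of_nonneg_left hΛ1 hNr.le]
  push Not at hsmall
  -- Case `N < N₀`: trivial bound, absorbed by the constant `(3/2) log^A (N₀ + 2)`
  have hlogA_le : Real.log N ^ A ≤ Real.log ((N₀ : ℝ) + 2) ^ A ∨ N₀ ≤ N := by
    by_cases hlt : N < N₀
    · left
      refine Real.rpow_le_rpow hlogpos.le (Real.log_le_log hNr ?_) hA.le
      have : (N : ℝ) ≤ N₀ := by exact_mod_cast hlt.le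
      linarith
    · right; exact not_lt.mp hlt
  rcases hlogA_le with hlogA_le | hN₀
  · refine htriv.trans ?_
    rw [le_div_iff₀ hLA]
    have h1 : 3 / 2 * (N : ℝ) * Real.log N ^ A ≤ 3 / 2 * Real.log ((N₀ : ℝ) + 2) ^ A * N := by
      have := mul_le_mul_of_nonneg_left hlogA_le (show (0:ℝ) ≤ 3 / 2 * N by positivity)
      linarith
    have h2 : 0 ≤ (2 * C₁ + 2) * (N : ℝ) := by positivity
    nlinarith
  -- the major-arc data
  obtain ⟨q, K, ρ₃, hq, hqB, hK, hKB, hρ₃B, hρ₃ρ, hMA⟩ :=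
    hB N hN₀ hN α n₀ ρ hρ hρ1 hball φ hφ ψ hψ0 hsupp hlip hcase
  set Q : ℝ := Real.log N ^ B with hQ
  have hQ1 : 1 ≤ Q := Real.one_le_rpow hsmall.le hB0
  have hQρ : 1 / Q ≤ ρ₃ := by rw [one_div]; exact hρ₃B
  -- the rescaled weight `ψ/2` and the `ℝ/ℤ`-valued phase
  set ψ₂ : ℤ → ℝ := fun n => ψ n / 2 with hψ₂
  set φ' : ℤ → UnitAddCircle := fun n => ((φ n : ℝ) : UnitAddCircle) with hφ'
  have hψ₂0 : ∀ n, 0 ≤ ψ₂ n := fun n => by simp only [hψ₂]; linarith [hψ0 n]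
  have hψ₂1 : ∀ n, ψ₂ n ≤ 1 := fun n => by simp only [hψ₂]; linarith [hψ32 n]
  have hψ₂ne : ∀ n, ψ₂ n ≠ 0 → ψ n ≠ 0 := fun n h h0 => h (by simp only [hψ₂, h0, zero_div])
  have hsupp₂ : ∀ n, ψ₂ n ≠ 0 → (N : ℤ) < n ∧ n ≤ 2 * N := by
    intro n hn
    have h := hsupp n (hψ₂ne n hn)
    refine hball n ⟨fun i => ?_, ?_⟩
    · have := h.1 i; linarith
    · linarith [h.2]
  have hloc₂ : ∀ n, ψ₂ n ≠ 0 →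
      (⨆ i : Fin k, ‖((((n - n₀ : ℤ) : ℝ) * α i : ℝ) : AddCircle (1 : ℝ))‖) +
        |((n - n₀ : ℤ) : ℝ)| / N < ρ := by
    intro n hn
    have h := hsupp n (hψ₂ne n hn)
    rcases isEmpty_or_nonempty (Fin k) with hk | hk
    · rw [Real.iSup_of_isEmpty, zero_add]; exact h.2
    · obtain ⟨i, hi⟩ := exists_eq_ciSup_of_finite
        (f := fun i : Fin k => ‖((((n - n₀ : ℤ) : ℝ) * α i : ℝ) : AddCircle (1 : ℝ))‖)
      rw [← hi]; exact h.1 i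
  have hlip₂ : ∀ n n' : ℤ, |ψ₂ n - ψ₂ n'| ≤
      (⨆ i : Fin k, ‖((((n - n' : ℤ) : ℝ) * α i : ℝ) : AddCircle (1 : ℝ))‖) +
        |((n - n' : ℤ) : ℝ)| / N := by
    intro n n'
    have h := hlip n n' (⨆ i : Fin k, ‖((((n - n' : ℤ) : ℝ) * α i : ℝ) : AddCircle (1 : ℝ))‖)
      (iSup_norm_nonneg α _) (fun i => le_ciSup (bddAbove_range_norm α (n - n')) i)
    have e : ψ₂ n - ψ₂ n' = (ψ n - ψ n') / 2 := by simp only [hψ₂]; ring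
    rw [e, abs_div, abs_two]
    have := abs_nonneg (ψ n - ψ n')
    have h0 : 0 ≤ (⨆ i : Fin k, ‖((((n - n' : ℤ) : ℝ) * α i : ℝ) : AddCircle (1 : ℝ))‖) +
        |((n - n' : ℤ) : ℝ)| / N := by have := iSup_norm_nonneg α (n - n'); positivity
    linarith
  have hφ' := cube_vanish_of_integral α N n₀ (100 * ρ) φ hφ
  -- apply §12
  have main := hC₁ N hN α n₀ (100 * ρ) K ρ₃ ρ Q q φ' ψ₂ hφ' hq hK hQ1 hqB hKB hQρ
    (by linarith) (by linarith) hMA hψ₂0 hψ₂1 hsupp₂ hloc₂ hlip₂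
  -- rescale and convert back
  have hconv : ∑ n ∈ Ioc N (2 * N), ((μ n : ℝ) : ℂ) * ((ψ n : ℝ) : ℂ) * (𝐞 (-(φ n)) : ℂ) =
      2 * ∑ n ∈ Ioc N (2 * N), ((μ n : ℝ) : ℂ) * ((ψ₂ n : ℝ) : ℂ) *
        ((AddCircle.toCircle (-φ' n) : Circle) : ℂ) := by
    rw [Finset.mul_sum, ← sum_toCircle_eq_sum_fourierChar]
    refine Finset.sum_congr rfl fun n _ => ?_
    simp only [hψ₂]
    push_cast
    ring
  rw [hconv, norm_mul, Complex.norm_two]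
  have hpow : Real.log N ^ (A + B * D) = Real.log N ^ A * Q ^ D := by
    rw [Real.rpow_add hlogpos, hQ, ← Real.rpow_mul_natCast hlogpos.le]
  rw [hpow] at main
  have hQD : 0 < Q ^ D := by positivity
  have main' : ‖∑ n ∈ Ioc N (2 * N), ((μ n : ℝ) : ℂ) * ((ψ₂ n : ℝ) : ℂ) *
      ((AddCircle.toCircle (-φ' n) : Circle) : ℂ)‖ ≤ C₁ * N / Real.log N ^ A := by
    refine main.trans (le_of_eq ?_)
    rw [hD]
    field_simp
  calc 2 * ‖∑ n ∈ Ioc N (2 * N), ((μ n : ℝ) : ℂ) * ((ψ₂ n : ℝ) : ℂ) *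
        ((AddCircle.toCircle (-φ' n) : Circle) : ℂ)‖ ≤ 2 * (C₁ * N / Real.log N ^ A) := by linarith
    _ ≤ (2 * C₁ + 2 + 3 / 2 * Real.log ((N₀ : ℝ) + 2) ^ A) * N / Real.log N ^ A := by
        rw [mul_div_assoc, mul_div_assoc]
        have : 0 ≤ (N : ℝ) / Real.log N ^ A := by positivity
        have : 0 ≤ Real.log ((N₀ : ℝ) + 2) ^ A := hLA0
        nlinarith


/-- **`stub_mnVertical` from the major-arc inverse statement of §§9–11 for large `N` (all torus
dimensions).**  The conclusion is the registered signature of `stub_mnVertical` verbatim (`B = 1`).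
[cite: GreenTao2008QuadraticMobius, §2 and §§8–12, App. A (the proof of the Main Theorem)] -/
theorem stub_mnVertical_of_majorArcInverse_largeN
    (hInv : ∀ k : ℕ, ∀ A : ℝ, 0 < A → ∃ B : ℝ, 0 ≤ B ∧ ∃ N₀ : ℕ, ∀ N : ℕ, N₀ ≤ N → 2 ≤ N →
      ∀ (α : Fin k → ℝ) (n₀ : ℤ) (ρ : ℝ),
      0 < ρ → 100000 * ρ < 1 →
      (∀ n : ℤ, ((∀ i, ‖((((n - n₀ : ℤ) : ℝ) * α i : ℝ) : AddCircle (1 : ℝ))‖ +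
          |((n - n₀ : ℤ) : ℝ)| / N < 100 * ρ) ∧ |((n - n₀ : ℤ) : ℝ)| / N < 100 * ρ) →
        (N : ℤ) < n ∧ n ≤ 2 * N) →
      ∀ φ : ℤ → ℝ,
        (∀ n h₁ h₂ h₃ : ℤ,
          (∀ e₁ e₂ e₃ : ℕ, e₁ ≤ 1 → e₂ ≤ 1 → e₃ ≤ 1 →
            (∀ i, ‖((((n + e₁ * h₁ + e₂ * h₂ + e₃ * h₃ - n₀ : ℤ) : ℝ) * α i : ℝ) :
                AddCircle (1 : ℝ))‖ +
              |((n + e₁ * h₁ + e₂ * h₂ + e₃ * h₃ - n₀ : ℤ) : ℝ)| / N < 100 * ρ) ∧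
            |((n + e₁ * h₁ + e₂ * h₂ + e₃ * h₃ - n₀ : ℤ) : ℝ)| / N < 100 * ρ) →
          ∃ z : ℤ, φ (n + h₁ + h₂ + h₃) - φ (n + h₁ + h₂) - φ (n + h₁ + h₃) - φ (n + h₂ + h₃)
            + φ (n + h₁) + φ (n + h₂) + φ (n + h₃) - φ n = z) →
        ∀ ψ : ℤ → ℝ, (∀ n, 0 ≤ ψ n) →
          (∀ n, ψ n ≠ 0 →
            (∀ i, ‖((((n - n₀ : ℤ) : ℝ) * α i : ℝ) : AddCircle (1 : ℝ))‖ +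
                |((n - n₀ : ℤ) : ℝ)| / N < ρ) ∧ |((n - n₀ : ℤ) : ℝ)| / N < ρ) →
          (∀ (n n' : ℤ) (t : ℝ), 0 ≤ t →
            (∀ i, ‖((((n - n' : ℤ) : ℝ) * α i : ℝ) : AddCircle (1 : ℝ))‖ ≤ t) →
              |ψ n - ψ n'| ≤ t + |((n - n' : ℤ) : ℝ)| / N) →
          (N : ℝ) / Real.log N ^ A ≤
            ‖∑ n ∈ Ioc N (2 * N), ((μ n : ℝ) : ℂ) * ((ψ n : ℝ) : ℂ) * (𝐞 (-(φ n)) : ℂ)‖ →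
          ∃ (q : ℕ) (K ρ₃ : ℝ), 1 ≤ q ∧ (q : ℝ) ≤ Real.log N ^ B ∧ 0 ≤ K ∧ K ≤ Real.log N ^ B ∧
            (Real.log N ^ B)⁻¹ ≤ ρ₃ ∧ ρ₃ ≤ ρ ∧
            ∀ a b : ℤ,
              (⨆ i : Fin k, ‖(((a : ℝ) * α i : ℝ) : AddCircle (1 : ℝ))‖) + |(a : ℝ)| / N < ρ₃ →
              (⨆ i : Fin k, ‖(((b : ℝ) * α i : ℝ) : AddCircle (1 : ℝ))‖) + |(b : ℝ)| / N < ρ₃ →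
              ‖q • ((((φ (n₀ + a + b) : ℝ) : UnitAddCircle)) - ((φ (n₀ + a) : ℝ) : UnitAddCircle)
                - ((φ (n₀ + b) : ℝ) : UnitAddCircle) + ((φ n₀ : ℝ) : UnitAddCircle))‖ ≤
                K * ((⨆ i : Fin k, ‖(((a : ℝ) * α i : ℝ) : AddCircle (1 : ℝ))‖) + |(a : ℝ)| / N) *
                  ((⨆ i : Fin k, ‖(((b : ℝ) * α i : ℝ) : AddCircle (1 : ℝ))‖) + |(b : ℝ)| / N)) :
    (∀ (d : HX → HX → ℝ) (h : IsCompatMetric d), IsBoxComparable d →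
      ∀ X : Nilmanifold 2, InHeisClass (heisenbergWith d h) X → ∀ m : ℕ,
        ∀ A : ℝ, 0 < A → ∃ C B : ℝ, ∀ M : ℝ, 1 ≤ M → ∀ N : ℕ, 2 ≤ N →
          ∀ (g : ((X.pow m).prod (Nilmanifold.circle.ofLE one_le_two)).G) (x : ((X.pow m).prod (Nilmanifold.circle.ofLE one_le_two)).G ⧸ ((X.pow m).prod (Nilmanifold.circle.ofLE one_le_two)).Γ) (F₁ F₂ : ((X.pow m).prod (Nilmanifold.circle.ofLE one_le_two)).G ⧸ ((X.pow m).prod (Nilmanifold.circle.ofLE one_le_two)).Γ → ℝ),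
            ((X.pow m).prod (Nilmanifold.circle.ofLE one_le_two)).IsBoundedLipschitz M F₁ → ((X.pow m).prod (Nilmanifold.circle.ofLE one_le_two)).IsBoundedLipschitz M F₂ →
            (∃ θ : ((X.pow m).prod (Nilmanifold.circle.ofLE one_le_two)).G → ℝ, ∀ z : ((X.pow m).prod (Nilmanifold.circle.ofLE one_le_two)).G, z ∈ Subgroup.center ((X.pow m).prod (Nilmanifold.circle.ofLE one_le_two)).G →
              ∀ x : ((X.pow m).prod (Nilmanifold.circle.ofLE one_le_two)).G ⧸ ((X.pow m).prod (Nilmanifold.circle.ofLE one_le_two)).Γ,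
                ((F₁ (z • x) : ℂ) + (F₂ (z • x) : ℂ) * Complex.I) =
                  Complex.exp (2 * Real.pi * Complex.I * θ z) * ((F₁ x : ℂ) + (F₂ x : ℂ) * Complex.I)) →
              ‖∑ n ∈ Finset.Icc 1 N, ((ArithmeticFunction.moebius n : ℝ) : ℂ) *
                  ((F₁ (g ^ n • x) : ℂ) + (F₂ (g ^ n • x) : ℂ) * Complex.I)‖ ≤
                C * M ^ B * N / Real.log N ^ A) :=
  stub_mnVertical_of_prop19 fun k => propNineteen_of_majorArcInverse_largeN k (hInv k)

end Summit.Parity.GeneralizedHardyLittlewood.GreenTaoLevelTwoMNTwoVerticalOfInverseLargeN
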